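import Summits.QuantumFields.YangMills.Theorems.UnitScaleTiltProp7FlatRRowConstTorus
import Summits.QuantumFields.YangMills.Theorems.UnitScaleTiltProp7CentreHarmonicDivDictionary
import HarnessLib

/-!
# Route `UnitScaleTilt`, crux K1 «MinimiserStabilityRegPr» (stmt-QuantumFields-19200), route-R E′ S3 ∕ line «HKGK-ANALYTIC» (C5)-FLAT, FILE 2 (the T³ letters) —
# `ℛ_flat ≤ C_B` IN `Site (F.P K) 0` LETTERS: for a coarse weight `ν` on the level-`k` bonds, MEAN-FREE per direction, and a fine real bond field `A` with
# `Δ A_κ = ((Q_k)ᵀν)_κ` componentwise (flat lattice Laplacian of [Balaban1984PropagatorsI] (1.21), `Q_k = bondAvgIter k` of (1.18)) and `A_κ ⊥ 1`,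
# `(L^k)²·Σ_b Σ_ν |A(b + e_ν) − A(b)|² ≤ C_B·Σ_b |A(b)|²`, `C_B = dπ² + (π²∕4)^{d+1}(dπ²)²∕4` (★ym-ust-19200-w4 g7's target statement, 2026-08-28 23:38:17Z)

Cell `ym3-torus`, twin-width seat `ym-ust-19936-w8` (gen 5).  THEOREMS ONLY (0 `def`, 0 `sorry`); `--supports stmt-QuantumFields-19200 --as helper`, count-neutral.  YM₃ on T³ is a
ladder rung (R3), not the Clay problem; nothing here claims S3, hKg-K, E′, the stub, the crux, d = 4 or the mass gap.

THE DICTIONARY.  `EK hk : Site P 0 ≃ Tor (fine (L^k) (Mk P k))` (✓`B5Eq117TorusCarriers`); under it `laplace 1 ↦ LapS … 1` (✓`Prop7CentreHarmonicDivDictionary.LapS_one_mulVec_transl`,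
`LapS … n = n²·LapS … 1`), unit steps ↦ unit steps (✓`BIJ85Thm711TorusTransport.EK_symm_add_unitVec`), and the straight composite `bondAvgIter k` IS the one-stroke
`B5Block118.QvOp (L^k) (Mk P k)` (✓`Qk_tV` ∘ ✓`cplx_Qk`; re-derived here for `ℂ`-valued fields in three lines from ✓`bondAvgIter_eq_blockSum` + ✓`EK_runSite_blockSiteK`), so the
transposed weight `f = (Q_k)ᵀν` — given ABSTRACTLY by its pairing `∀ Y, Σ_c ν(c)·(Q_kY)(c) = Σ_b f(b)·Y(b)` (the shape ✓p676806 `sum_smul_iterLinAvg_eq_of_coclosed` delivers for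
the `linAvg`-composite against a CO-CLOSED `ν`, with the factor `L^k`; any scalar multiple is fine: FILE 1 is scale-free) — reads `((QvOp)ᴴν̃)_κ ∘ EK`; then FILE 1
✓`Prop7FlatRRowConstTorus.bernstein_interpolant`.

WHAT IS PROVED (ns `…Theorems.Prop7FlatRRowConst`; any `P : Params`, `k ≤ m + K`):
* §1 `bondAvgIter_eq_QvOp_mulVec` (ℂ-valued fields), `transpose_eq_QvOp_adjoint` (the abstract `f` IS `(QvOp)ᴴν̃` under `EK`), `LapS_one_mulVec_EK` (real `ψ`, no translate).
* §2 ★★ `bernstein_component` — one component `κ`: `(L^k)²·Σ_νΣ_x (A_κ(x+e_ν) − A_κ(x))² ≤ C_B·Σ_x A_κ(x)²`.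
* §3 ★★★ `flatRRow_const` — all components: `(L^k)²·Σ_b Σ_ν (A(b + e_ν) − A(b))² ≤ C_B·Σ_b A(b)²`; `flatRRow_const_T3` the T³ instance (`k = K − n`).
HONEST SCOPE.  Flat, linear bookkeeping between two typings of one torus + FILE 1; no new estimate; co-closedness of `ν` is NOT needed here (it is what turns the `linAvg`-composite
into `L^k·bondAvgIter`, ✓p676806 — the consumer's step); `C_B` absolute but crude (sharp ≈ 31.4, px12 (K3)).

References: T. Bałaban, CMP 95 (1984) 17–40 [Balaban1984PropagatorsI] ((1.4) p.18, (1.18) p.20, (1.21) p.21, Sect. C p.22); CMP 99 (1985) 389–434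
[Balaban1985BackgroundPropagators] (Thm 3.11 p.416).
-/

set_option autoImplicit false

noncomputable section

open scoped BigOperators Matrix ComplexConjugate

namespace Summit.QuantumFields.YangMills.Theorems.Prop7FlatRRowConst

open Literature.MathematicalPhysics.QuantumFieldTheory.Balaban1983to89
open Finset LatticeFieldCalculus
open B10StarCount (sum_pbond)
open B5Prop11Plancherel (Tor fine unitVec)
open B5Block118 (QvOp QvOp_mulVec lineSum bpt tstep)
open B5Action121 (LapS comp)
open B5Eq117TorusCarriers (Mk EK sum_iterBlock_eq EK_runSite_blockSiteK)
open B5Eq118OneStroke (bondAvgIter_eq_blockSum)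
open Summit.QuantumFields.YangMills.Theorems.Prop7CentreHarmonicDivDictionary (LapS_natCast_mulVec LapS_one_mulVec_transl)
open Literature.MathematicalPhysics.QuantumFieldTheory.BalabanImbrieJaffe1984to88.BIJ85Thm711TorusTransport (EK_symm_add_unitVec)
open Summit.QuantumFields.YangMills.Theorems.Prop7FlatRRowConstTorus (bernstein_interpolant)

variable {P : Params} {k : ℕ}

/-! ## §1 Dictionary letters -/

/-- **(1.18) FOR `ℂ`-VALUED FIELDS UNDER `EK`**: `(Q_kY)(⟨y, μ⟩) = (QvOp (L^k) Mk *ᵥ (Y ∘ EK⁻¹))(y, μ)` — ✓`bondAvgIter_eq_blockSum` read through ✓`EK_runSite_blockSiteK`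
(the proof of ✓`Qk_tV`, without the real-field carrier). [cite: Balaban1984PropagatorsI, (1.18) p.20] -/
theorem bondAvgIter_eq_QvOp_mulVec (hk : k ≤ P.m + P.K) (Y : PBond P 0 → ℂ) (y : Site P k) (μ : Fin P.d) :
    bondAvgIter k Y ⟨y, μ⟩ = (QvOp (P.L ^ k) (Mk P k) *ᵥ (fun i => Y ⟨(EK hk).symm i.1, i.2⟩)) (y, μ) := by
  rw [QvOp_mulVec, bondAvgIter_eq_blockSum k hk Y ⟨y, μ⟩, sum_iterBlock_eq hk]
  simp only [lineSum]
  have hpt : ∀ (j : Fin P.d → Fin (P.L ^ k)) (t : ℕ),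
      (EK hk).symm (bpt (P.L ^ k) (Mk P k) y j + tstep (fine (P.L ^ k) (Mk P k)) μ t)
        = runSite (B5Eq117TorusCarriers.blockSiteK k y j) μ t := by
    intro j t
    rw [Equiv.symm_apply_eq, EK_runSite_blockSiteK]
  simp only [hpt]
  simp only [segSum, runBond]
  have hcoef : ((((P.L : ℝ) ^ (P.d + 1)) ^ k)⁻¹ : ℝ) • (∑ j : Fin P.d → Fin (P.L ^ k), ∑ t ∈ Finset.range (P.L ^ k),
        Y ⟨runSite (B5Eq117TorusCarriers.blockSiteK k y j) μ t, μ⟩)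
      = 1 / ((((P.L ^ k : ℕ)) : ℂ)) ^ (P.d + 1) * (∑ j : Fin P.d → Fin (P.L ^ k), ∑ t ∈ Finset.range (P.L ^ k),
        Y ⟨runSite (B5Eq117TorusCarriers.blockSiteK k y j) μ t, μ⟩) := by
    rw [Complex.real_smul]
    congr 1
    push_cast
    rw [one_div, ← pow_mul, ← pow_mul, mul_comm k]
  rw [hcoef]
  congr 1
  refine Finset.sum_congr rfl fun j _ => ?_
  rw [Fin.sum_univ_eq_sum_range (fun t => Y ⟨runSite (B5Eq117TorusCarriers.blockSiteK k y j) μ t, μ⟩) (P.L ^ k)]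

/-- **THE TRANSPOSED WEIGHT IS `(Q_k)ᴴν̃` UNDER `EK`**: if `f` pairs like the transpose of `Q_k` against the (real) coarse weight `ν` — `∀ Y, Σ_c ν(c)·(Q_kY)(c) = Σ_b f(b)·Y(b)` —
then `f(⟨x, κ⟩) = ((QvOp)ᴴν̃)(EK x, κ)` (test `Y` = the indicator of one bond; `QvOp` has real entries). [cite: Balaban1984PropagatorsI, (1.18) p.20] -/
theorem transpose_eq_QvOp_adjoint (hk : k ≤ P.m + P.K) (ν : PBond P k → ℝ) (f : PBond P 0 → ℝ)
    (hf : ∀ Y : PBond P 0 → ℝ, ∑ c : PBond P k, ν c * bondAvgIter k Y c = ∑ b : PBond P 0, f b * Y b)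
    (x : Site P 0) (κ : Fin P.d) :
    ((f ⟨x, κ⟩ : ℝ) : ℂ) = ((QvOp (P.L ^ k) (Mk P k))ᴴ *ᵥ (fun c : Tor (Mk P k) × Fin P.d => ((ν ⟨c.1, c.2⟩ : ℝ) : ℂ))) (EK hk x, κ) := by
  classical
  -- the indicator of the bond `⟨x, κ⟩`
  set Y : PBond P 0 → ℝ := fun b => if b = ⟨x, κ⟩ then 1 else 0 with hY
  have hR : ∑ b : PBond P 0, f b * Y b = f ⟨x, κ⟩ := by
    simp only [hY, mul_ite, mul_one, mul_zero, Finset.sum_ite_eq', Finset.mem_univ, if_true]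
  have h := hf Y
  rw [hR] at h
  rw [← h]
  push_cast
  -- each `Q_kY(c)` is the matrix entry `QvOp c (EK x, κ)`
  have hQ : ∀ c : PBond P k, ((bondAvgIter k Y c : ℝ) : ℂ) = QvOp (P.L ^ k) (Mk P k) (c.src, c.dir) (EK hk x, κ) := by
    intro c
    have hc : c = ⟨c.src, c.dir⟩ := rfl
    -- cast `Y` to `ℂ`: `bondAvgIter` is `ℝ`-linear bookkeeping, so read the ℂ-valued indicator directly
    have e1 : ((bondAvgIter k Y c : ℝ) : ℂ) = bondAvgIter k (fun b => ((Y b : ℝ) : ℂ)) c := by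
      rw [hc, bondAvgIter_eq_blockSum k hk Y ⟨c.src, c.dir⟩, bondAvgIter_eq_blockSum k hk (fun b => ((Y b : ℝ) : ℂ)) ⟨c.src, c.dir⟩,
        smul_eq_mul, Complex.real_smul]
      push_cast
      simp only [segSum, Complex.ofReal_sum]
    rw [e1, hc, bondAvgIter_eq_QvOp_mulVec hk]
    simp only [Matrix.mulVec, dotProduct, hY]
    rw [Finset.sum_eq_single (EK hk x, κ)]
    · simp
    · intro i _ hi
      have hne : (⟨(EK hk).symm i.1, i.2⟩ : PBond P 0) ≠ ⟨x, κ⟩ := by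
        intro heq
        apply hi
        have h1 : (EK hk).symm i.1 = x := congrArg PBond.src heq
        have h2 : i.2 = κ := congrArg PBond.dir heq
        exact Prod.ext ((Equiv.symm_apply_eq _).mp h1) h2
      rw [if_neg hne]
      push_cast
      rw [mul_zero]
    · intro h; exact absurd (Finset.mem_univ _) h
  simp only [Matrix.mulVec, dotProduct, Matrix.conjTranspose_apply]
  rw [← Fintype.sum_equiv (LatticeFieldCalculus.bondEquiv (P := P) (j := k))
    (fun i => ((ν (LatticeFieldCalculus.bondEquiv i) : ℝ) : ℂ) * ((bondAvgIter k Y (LatticeFieldCalculus.bondEquiv i) : ℝ) : ℂ))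
    (fun c => ((ν c : ℝ) : ℂ) * ((bondAvgIter k Y c : ℝ) : ℂ)) (fun _ => rfl)]
  refine Finset.sum_congr rfl fun i _ => ?_
  obtain ⟨y, μ⟩ := i
  have hi : (LatticeFieldCalculus.bondEquiv (y, μ) : PBond P k) = ⟨y, μ⟩ := rfl
  rw [hi, hQ ⟨y, μ⟩]
  -- the entries of `QvOp` are real
  have hreal : star (QvOp (P.L ^ k) (Mk P k) (y, μ) (EK hk x, κ)) = QvOp (P.L ^ k) (Mk P k) (y, μ) (EK hk x, κ) := by
    simp only [QvOp]
    split_ifs <;> simp [apply_ite star]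
  exact (mul_comm _ _).trans (congrArg (fun z : ℂ => z * (((ν ⟨y, μ⟩ : ℝ)) : ℂ)) hreal.symm)

/-- **`Δ` UNDER THE DICTIONARY, no translate**: `(LapS … 1 *ᵥ (ψ ∘ EK⁻¹))(t) = (laplace 1 ψ)(EK⁻¹ t)` (✓`LapS_one_mulVec_transl` at `w = 0`). [cite: Balaban1984PropagatorsI, (1.21) p.21] -/
theorem LapS_one_mulVec_EK (hk : k ≤ P.m + P.K) (ψ : SiteField P 0 ℝ) (t : Tor (fine (P.L ^ k) (Mk P k))) :
    (LapS (fine (P.L ^ k) (Mk P k)) 1 *ᵥ (fun s => ((ψ ((EK hk).symm s) : ℝ) : ℂ))) t = ((laplace 1 ψ ((EK hk).symm t) : ℝ) : ℂ) := by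
  have h := LapS_one_mulVec_transl hk ψ 0 t
  simp only [add_zero] at h
  exact h

/-! ## §2 One component -/

/-- ★★ **BERNSTEIN FOR THE CURL-MINIMAL INTERPOLANT, ONE COMPONENT, `Site P 0` LETTERS**: `ν` a real weight on the level-`k` bonds with `Σ_y ν⟨y,κ⟩ = 0`; `f` its `Q_k`-transpose
(`∀ Y, Σ_c ν(c)·(Q_kY)(c) = Σ_b f(b)·Y(b)`, `Q_k = bondAvgIter k`); `A : PBond P 0 → ℝ` with `Δ A_κ = f_κ` (flat `laplace 1` on the site function `x ↦ A⟨x,κ⟩`) and `Σ_x A⟨x,κ⟩ = 0`.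
THEN `(L^k)²·Σ_ν Σ_x (A⟨x+e_ν,κ⟩ − A⟨x,κ⟩)² ≤ C_B·Σ_x A⟨x,κ⟩²`, `C_B = dπ² + (π²∕4)^{d+1}(dπ²)²∕4`.
[cite: Balaban1984PropagatorsI, (1.18) p.20, (1.21) p.21, Sect. C p.22; Balaban1985BackgroundPropagators, Thm 3.11 p.416] -/
theorem bernstein_component (hk : k ≤ P.m + P.K) (ν : PBond P k → ℝ) (κ : Fin P.d) (hν : ∑ y : Site P k, ν ⟨y, κ⟩ = 0)
    (A f : PBond P 0 → ℝ)
    (hf : ∀ Y : PBond P 0 → ℝ, ∑ c : PBond P k, ν c * bondAvgIter k Y c = ∑ b : PBond P 0, f b * Y b)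
    (hLap : ∀ x : Site P 0, laplace 1 (fun z => A ⟨z, κ⟩) x = f ⟨x, κ⟩)
    (hA0 : ∑ x : Site P 0, A ⟨x, κ⟩ = 0) :
    ((P.L : ℝ) ^ k) ^ 2 * ∑ ν' : Fin P.d, ∑ x : Site P 0, (A ⟨x.shift ν', κ⟩ - A ⟨x, κ⟩) ^ 2
      ≤ (P.d * Real.pi ^ 2 + (Real.pi ^ 2 / 4) ^ (P.d + 1) * (P.d * Real.pi ^ 2) ^ 2 / 4) * ∑ x : Site P 0, A ⟨x, κ⟩ ^ 2 := by
  -- letters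
  have hL0 : 0 < P.L := P.L_pos
  have hn1 : 1 ≤ P.L ^ k := Nat.one_le_pow _ _ hL0
  let E := EK hk
  let u : Tor (fine (P.L ^ k) (Mk P k)) → ℂ := fun s => ((A ⟨E.symm s, κ⟩ : ℝ) : ℂ)
  let B : Tor (Mk P k) × Fin P.d → ℂ := fun c => ((ν ⟨c.1, c.2⟩ : ℝ) : ℂ)
  -- hypotheses on the carrier
  have hB : ∑ y, B (y, κ) = 0 := by
    show ∑ y : Tor (Mk P k), ((ν ⟨y, κ⟩ : ℝ) : ℂ) = 0
    rw [← Complex.ofReal_sum]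
    exact_mod_cast hν
  have hu : ∑ s, u s = 0 := by
    show ∑ s, ((A ⟨E.symm s, κ⟩ : ℝ) : ℂ) = 0
    rw [Fintype.sum_equiv E.symm (fun s => ((A ⟨E.symm s, κ⟩ : ℝ) : ℂ)) (fun x => ((A ⟨x, κ⟩ : ℝ) : ℂ)) (fun _ => rfl),
      ← Complex.ofReal_sum, hA0, Complex.ofReal_zero]
  have hLapT : LapS (fine (P.L ^ k) (Mk P k)) ((P.L ^ k : ℕ) : ℂ) *ᵥ u
      = (((P.L ^ k : ℕ) : ℂ) ^ 2) • comp (fine (P.L ^ k) (Mk P k)) ((QvOp (P.L ^ k) (Mk P k))ᴴ *ᵥ B) κ := by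
    funext t
    rw [LapS_natCast_mulVec, Pi.smul_apply, smul_eq_mul]
    congr 1
    show (LapS (fine (P.L ^ k) (Mk P k)) 1 *ᵥ (fun s => ((A ⟨E.symm s, κ⟩ : ℝ) : ℂ))) t = ((QvOp (P.L ^ k) (Mk P k))ᴴ *ᵥ B) (t, κ)
    rw [LapS_one_mulVec_EK hk (fun z => A ⟨z, κ⟩) t, hLap, transpose_eq_QvOp_adjoint hk ν f hf (E.symm t) κ]
    simp only [E, Equiv.apply_symm_apply]
    rfl
  -- FILE 1
  have key := bernstein_interpolant (P.L ^ k) (Mk P k) hn1 B κ hB _ u hu hLapT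
  -- read back
  have hL : ∑ ν' : Fin P.d, ∑ s, ‖u (s + unitVec (fine (P.L ^ k) (Mk P k)) ν') - u s‖ ^ 2
      = ∑ ν' : Fin P.d, ∑ x : Site P 0, (A ⟨x.shift ν', κ⟩ - A ⟨x, κ⟩) ^ 2 := by
    refine Finset.sum_congr rfl fun ν' _ => ?_
    have e : ∀ s, ‖u (s + unitVec (fine (P.L ^ k) (Mk P k)) ν') - u s‖ ^ 2 = (A ⟨(E.symm s).shift ν', κ⟩ - A ⟨E.symm s, κ⟩) ^ 2 := by
      intro s
      show ‖((A ⟨E.symm (s + unitVec _ ν'), κ⟩ : ℝ) : ℂ) - ((A ⟨E.symm s, κ⟩ : ℝ) : ℂ)‖ ^ 2 = _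
      rw [EK_symm_add_unitVec, ← Complex.ofReal_sub, Complex.norm_real, Real.norm_eq_abs, sq_abs]
    simp_rw [e]
    exact Fintype.sum_equiv E.symm _ _ (fun s => rfl)
  have hR : ∑ s, ‖u s‖ ^ 2 = ∑ x : Site P 0, A ⟨x, κ⟩ ^ 2 := by
    have e : ∀ s, ‖u s‖ ^ 2 = A ⟨E.symm s, κ⟩ ^ 2 := fun s => by
      show ‖((A ⟨E.symm s, κ⟩ : ℝ) : ℂ)‖ ^ 2 = _
      rw [Complex.norm_real, Real.norm_eq_abs, sq_abs]
    simp_rw [e]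
    exact Fintype.sum_equiv E.symm _ _ (fun s => rfl)
  have hcast : (((P.L ^ k : ℕ)) : ℝ) = (P.L : ℝ) ^ k := by push_cast; ring
  rw [hL, hR, hcast] at key
  exact key

/-! ## §3 All components; the T³ instance -/

/-- ★★★ **`ℛ_flat ≤ C_B` IN `Site P 0` LETTERS** (★w4-19200 g7's target): `ν` a real level-`k` weight MEAN-FREE in every direction; `f` its `Q_k`-transpose; `A` a fine real bond field
with `Δ A_κ = f_κ` for every component and `Σ_x A⟨x,κ⟩ = 0`.  THEN `(L^k)²·Σ_b Σ_ν (A(b + e_ν) − A(b))² ≤ C_B·Σ_b A(b)²` — the flat Dirichlet energy of the curl-minimal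
interpolant is `ℓ⁻²`-dominated by its mass, `C_B = dπ² + (π²∕4)^{d+1}(dπ²)²∕4` absolute, uniform in `k` and in the volume (sum of §2 over `κ`).
[cite: Balaban1984PropagatorsI, (1.18) p.20, (1.21) p.21, Sect. C p.22; Balaban1985BackgroundPropagators, Thm 3.11 p.416] -/
theorem flatRRow_const (hk : k ≤ P.m + P.K) (ν : PBond P k → ℝ) (hν : ∀ κ : Fin P.d, ∑ y : Site P k, ν ⟨y, κ⟩ = 0)
    (A f : PBond P 0 → ℝ)
    (hf : ∀ Y : PBond P 0 → ℝ, ∑ c : PBond P k, ν c * bondAvgIter k Y c = ∑ b : PBond P 0, f b * Y b)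
    (hLap : ∀ b : PBond P 0, laplace 1 (fun z => A ⟨z, b.dir⟩) b.src = f b)
    (hA0 : ∀ κ : Fin P.d, ∑ x : Site P 0, A ⟨x, κ⟩ = 0) :
    ((P.L : ℝ) ^ k) ^ 2 * ∑ b : PBond P 0, ∑ ν' : Fin P.d, (A ⟨b.src.shift ν', b.dir⟩ - A b) ^ 2
      ≤ (P.d * Real.pi ^ 2 + (Real.pi ^ 2 / 4) ^ (P.d + 1) * (P.d * Real.pi ^ 2) ^ 2 / 4) * ∑ b : PBond P 0, A b ^ 2 := by
  have hcomp : ∀ κ : Fin P.d, ((P.L : ℝ) ^ k) ^ 2 * ∑ ν' : Fin P.d, ∑ x : Site P 0, (A ⟨x.shift ν', κ⟩ - A ⟨x, κ⟩) ^ 2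
      ≤ (P.d * Real.pi ^ 2 + (Real.pi ^ 2 / 4) ^ (P.d + 1) * (P.d * Real.pi ^ 2) ^ 2 / 4) * ∑ x : Site P 0, A ⟨x, κ⟩ ^ 2 :=
    fun κ => bernstein_component hk ν κ (hν κ) A f hf (fun x => hLap ⟨x, κ⟩) (hA0 κ)
  have h : ((P.L : ℝ) ^ k) ^ 2 * ∑ κ : Fin P.d, ∑ ν' : Fin P.d, ∑ x : Site P 0, (A ⟨x.shift ν', κ⟩ - A ⟨x, κ⟩) ^ 2
      ≤ (P.d * Real.pi ^ 2 + (Real.pi ^ 2 / 4) ^ (P.d + 1) * (P.d * Real.pi ^ 2) ^ 2 / 4) * ∑ κ : Fin P.d, ∑ x : Site P 0, A ⟨x, κ⟩ ^ 2 := by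
    rw [Finset.mul_sum, Finset.mul_sum]
    exact Finset.sum_le_sum fun κ _ => hcomp κ
  have eL : ∑ b : PBond P 0, ∑ ν' : Fin P.d, (A ⟨b.src.shift ν', b.dir⟩ - A b) ^ 2
      = ∑ κ : Fin P.d, ∑ ν' : Fin P.d, ∑ x : Site P 0, (A ⟨x.shift ν', κ⟩ - A ⟨x, κ⟩) ^ 2 := by
    rw [sum_pbond, Finset.sum_comm]
    refine Finset.sum_congr rfl fun κ _ => ?_
    rw [Finset.sum_comm]
  have eR : ∑ b : PBond P 0, A b ^ 2 = ∑ κ : Fin P.d, ∑ x : Site P 0, A ⟨x, κ⟩ ^ 2 := by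
    rw [sum_pbond, Finset.sum_comm]
  rw [eL, eR]
  exact h

/-- ★ **THE T³ INSTANCE** (run `K` of a T³ family, comparison height `n`, `k = K − n`, `ℓ = L^{K−n}`, `d = 3`): `ℓ²·Σ_bΣ_ν(A(b+e_ν) − A(b))² ≤ C_B·Σ_b A(b)²` for the
curl-minimal interpolant of a per-direction mean-free level-`(K−n)` weight. [cite: Balaban1984PropagatorsI, (1.18) p.20, (1.21) p.21; Balaban1985BackgroundPropagators, Thm 3.11 p.416] -/
theorem flatRRow_const_T3 (F : T3ContinuumYM3Torus.T3Family) (K n : ℕ) (ν : PBond (F.P K) (K - n) → ℝ)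
    (hν : ∀ κ : Fin (F.P K).d, ∑ y : Site (F.P K) (K - n), ν ⟨y, κ⟩ = 0)
    (A f : PBond (F.P K) 0 → ℝ)
    (hf : ∀ Y : PBond (F.P K) 0 → ℝ, ∑ c : PBond (F.P K) (K - n), ν c * bondAvgIter (K - n) Y c = ∑ b : PBond (F.P K) 0, f b * Y b)
    (hLap : ∀ b : PBond (F.P K) 0, laplace 1 (fun z => A ⟨z, b.dir⟩) b.src = f b)
    (hA0 : ∀ κ : Fin (F.P K).d, ∑ x : Site (F.P K) 0, A ⟨x, κ⟩ = 0) :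
    ((F.L : ℝ) ^ (K - n)) ^ 2 * ∑ b : PBond (F.P K) 0, ∑ ν' : Fin (F.P K).d, (A ⟨b.src.shift ν', b.dir⟩ - A b) ^ 2
      ≤ ((F.P K).d * Real.pi ^ 2 + (Real.pi ^ 2 / 4) ^ ((F.P K).d + 1) * ((F.P K).d * Real.pi ^ 2) ^ 2 / 4) * ∑ b : PBond (F.P K) 0, A b ^ 2 := by
  have hk : K - n ≤ (F.P K).m + (F.P K).K := by
    have := F.hm
    show K - n ≤ F.m + K
    omega
  exact flatRRow_const (P := F.P K) hk ν hν A f hf hLap hA0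

end Summit.QuantumFields.YangMills.Theorems.Prop7FlatRRowConst

end
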